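import Summits.QuantumFields.YangMills.Theorems.AllWindowsColdBoxBoxHighLinePlaquetteEdgeMoments

/-!
# Gaussian HIGH moments of the plaquette edge energy: `E₀[S^{2r}] ≤ (2r−1)^{2r}·E₀[S²]^r ≤ (2r−1)^{2r}·(C₂/β²)^r`, `S = Σ_{i<4}‖v_i‖²`

Tool for the Wick layer of STEP 2 of the XL stub S5 (LINE-19 ⟨stmt-QuantumFields-24004⟩/⟨24335⟩; planner ym-idea-2 g18) — the LEAD's T-S5.12a/10
«part 7: tenth moments `E₀‖plaqVar i‖^{10}`» and the quintic remainders of the cubic vertex: every power of the edge energy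
`S(a) = Σ_{i<4} ‖plaqVar H x μ ν a i‖²` of a plaquette has Gaussian size `β^{−k}`:

* ★ `gaussAvg_edgeSq_pow_even_le_pow` — `E₀[S^{2r}] ≤ (2r−1)^{2r} · E₀[S²]^r` (`r ≥ 1`; Gaussian hypercontractivity ✓`Hypercontractivity.integral_pow_mul_exp_quadForm_le_of_polyDeg`
  for the degree-2 flat polynomial `S`, ✓`PlaqObsL2.polyDeg_edgeSq`);
* ★ `gaussAvg_edgeSq_pow_even_le` — `E₀[S^{2r}] ≤ (2r−1)^{2r} · (60·1036²)^r / β^{2r}` (✓`PlaqObsL2.gaussAvg_edgeSq_sq_le`);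
* `gaussAvg_edgeSq_pow_odd_le` — `E₀[S^{2r+1}] ≤ ((2r−1)^{2r}C₂^r + (2r+1)^{2r+2}C₂^{r+1}) / (2β^{2r+1})` (AM–GM between the neighbouring even powers);
* `norm_plaqVar_pow_le_edgeSq_pow` — `‖v_i‖^{2k} ≤ S^k`, and `gaussAvg_norm_plaqVar_pow_le` — `E₀[‖v_i‖^{2k}] ≤ E₀[S^k]`.

Tree only; no definitions.  HONEST LABEL: a tool for STEP 2 of the XL stub S5 of a critic-PASSed DRAFT line; 12a, 10, S5, U5, ⟨stmt-QuantumFields-24004⟩ ⟨24335⟩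
⟨24336⟩ remain OPEN; route AllWindowsColdBox is DRAFT; **the Yang–Mills mass gap is NOT proved by this file; no summit is proved by a line.**
Seat ym-line-sfw-p2-w5 g22 (EXTRA WIDTH seat w5, cell ym-idea-1).
-/

set_option autoImplicit false

noncomputable section

open MeasureTheory Matrix Finset
open scoped Kronecker
open Literature.Probability.LatticeModels (Site)
open Literature.MathematicalPhysics.QuantumLattice (ZdEdge)

namespace Summit.QuantumFields.YangMills.Theorems.AllWindowsColdBoxBoxHighLine

namespace PlaqObsL2

open Hypercontractivity
open LaplaceSandwich (flatten)

variable (H : ℕ)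

/-- ★ **`E₀[S^{2r}] ≤ (2r−1)^{2r} · E₀[S²]^r`** (`r ≥ 1`): Gaussian hypercontractivity for the degree-2 flat polynomial `S`. -/
theorem gaussAvg_edgeSq_pow_even_le_pow {β : ℝ} (hβ : 0 < β) (x : Site 4) (μ ν : Fin 4) (r : ℕ) (hr : 1 ≤ r) :
    gaussAvg β H (fun a => (∑ i : Fin 4, ‖plaqVar H x μ ν a i‖ ^ 2) ^ (2 * r)) ≤
      (2 * r - 1 : ℝ) ^ (2 * r) * gaussAvg β H (fun a => (∑ i : Fin 4, ‖plaqVar H x μ ν a i‖ ^ 2) ^ 2) ^ r := by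
  have hZ := PlaqObsL4.integral_gaussWeight_pos H hβ
  set P : Matrix (LandauFree H × Fin 3) (LandauFree H × Fin 3) ℝ := hodgeQ H ⊗ₖ (1 : Matrix (Fin 3) (Fin 3) ℝ) with hP
  have hPd : P.PosDef := GaussianChartWick.posDef_kronecker_one _ (hodgeQ_posDef H)
  have hG := polyDeg_edgeSq H x μ ν
  have hH := integral_pow_mul_exp_quadForm_le_of_polyDeg P hPd hβ hG r hr
  rw [← integral_exp_neg_quadForm' P hPd hβ, show r * 2 = 2 * r from mul_comm _ _] at hH
  -- transfer of the three integrals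
  have hk : ∀ k : ℕ, ∫ a : LandauFree H → E3, (∑ i : Fin 4, ‖plaqVar H x μ ν a i‖ ^ 2) ^ k * gaussWeight β H a =
      ∫ v : LandauFree H × Fin 3 → ℝ, (∑ i : Fin 4, ∑ c : Fin 3,
        ((fun p : LandauFree H × Fin 3 => if p.2 = c then
            (fun e : LandauFree H => if (e.1.1 : ZdEdge 4) = plaqEdge x μ ν i then (1 : ℝ) else 0) p.1 else 0) ⬝ᵥ v) ^ 2) ^ k *
          Real.exp (-(β * (v ⬝ᵥ (P *ᵥ v)))) := by
    intro k
    rw [← EdgeChartGaussian.integral_eq_flat]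
    refine integral_congr_ae (Filter.Eventually.of_forall fun a => ?_)
    simp only [edgeSq_eq_flat, gaussWeight_eq_flat]
    rfl
  have h0 : ∫ a : LandauFree H → E3, gaussWeight β H a =
      ∫ v : LandauFree H × Fin 3 → ℝ, Real.exp (-(β * (v ⬝ᵥ (P *ᵥ v)))) := by
    rw [← EdgeChartGaussian.integral_eq_flat]
    refine integral_congr_ae (Filter.Eventually.of_forall fun a => ?_)
    simp only [gaussWeight_eq_flat]
    rfl
  unfold gaussAvg
  rw [hk (2 * r), hk 2, h0]
  rw [h0] at hZ
  set A := ∫ v : LandauFree H × Fin 3 → ℝ, (∑ i : Fin 4, ∑ c : Fin 3,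
        ((fun p : LandauFree H × Fin 3 => if p.2 = c then
            (fun e : LandauFree H => if (e.1.1 : ZdEdge 4) = plaqEdge x μ ν i then (1 : ℝ) else 0) p.1 else 0) ⬝ᵥ v) ^ 2) ^ (2 * r) *
          Real.exp (-(β * (v ⬝ᵥ (P *ᵥ v)))) with hA
  set B := ∫ v : LandauFree H × Fin 3 → ℝ, (∑ i : Fin 4, ∑ c : Fin 3,
        ((fun p : LandauFree H × Fin 3 => if p.2 = c then
            (fun e : LandauFree H => if (e.1.1 : ZdEdge 4) = plaqEdge x μ ν i then (1 : ℝ) else 0) p.1 else 0) ⬝ᵥ v) ^ 2) ^ 2 *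
          Real.exp (-(β * (v ⬝ᵥ (P *ᵥ v)))) with hB
  set Z := ∫ v : LandauFree H × Fin 3 → ℝ, Real.exp (-(β * (v ⬝ᵥ (P *ᵥ v)))) with hZdef
  -- `Z^{r−1}·A ≤ (2r−1)^{2r}·B^r`  ⇒  `A/Z ≤ (2r−1)^{2r}·(B/Z)^r`
  have hr' : r - 1 + 1 = r := Nat.sub_add_cancel hr
  have hZr : 0 < Z ^ r := pow_pos hZ r
  have e1 : A / Z = Z ^ (r - 1) * A / Z ^ r := by
    rw [div_eq_div_iff hZ.ne' hZr.ne']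
    conv_lhs => rw [← hr', pow_succ]
    ring
  rw [e1, div_pow]
  calc Z ^ (r - 1) * A / Z ^ r ≤ (2 * r - 1 : ℝ) ^ (2 * r) * B ^ r / Z ^ r := div_le_div_of_nonneg_right hH hZr.le
    _ = (2 * r - 1 : ℝ) ^ (2 * r) * (B ^ r / Z ^ r) := by ring

/-- ★ **`E₀[S^{2r}] ≤ (2r−1)^{2r} · (60·1036²)^r / β^{2r}`** (`r ≥ 1`). -/
theorem gaussAvg_edgeSq_pow_even_le {β : ℝ} (hβ : 0 < β) (x : Site 4) (μ ν : Fin 4) (r : ℕ) (hr : 1 ≤ r) :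
    gaussAvg β H (fun a => (∑ i : Fin 4, ‖plaqVar H x μ ν a i‖ ^ 2) ^ (2 * r)) ≤
      (2 * r - 1 : ℝ) ^ (2 * r) * (60 * 1036 ^ 2) ^ r / β ^ (2 * r) := by
  have h2 := gaussAvg_edgeSq_sq_le H hβ x μ ν
  have h2' : 0 ≤ gaussAvg β H (fun a => (∑ i : Fin 4, ‖plaqVar H x μ ν a i‖ ^ 2) ^ 2) := by
    unfold gaussAvg
    exact div_nonneg (integral_nonneg fun a => mul_nonneg (sq_nonneg _) (Real.exp_pos _).le)
      (PlaqObsL4.integral_gaussWeight_pos H hβ).le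
  have hr0 : (0 : ℝ) ≤ (2 * r - 1 : ℝ) ^ (2 * r) := by
    have : (1 : ℝ) ≤ 2 * r := by exact_mod_cast (show 1 ≤ 2 * r by omega)
    exact pow_nonneg (by linarith) _
  calc gaussAvg β H (fun a => (∑ i : Fin 4, ‖plaqVar H x μ ν a i‖ ^ 2) ^ (2 * r))
      ≤ (2 * r - 1 : ℝ) ^ (2 * r) * gaussAvg β H (fun a => (∑ i : Fin 4, ‖plaqVar H x μ ν a i‖ ^ 2) ^ 2) ^ r :=
        gaussAvg_edgeSq_pow_even_le_pow H hβ x μ ν r hr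
    _ ≤ (2 * r - 1 : ℝ) ^ (2 * r) * (60 * 1036 ^ 2 / β ^ 2) ^ r :=
        mul_le_mul_of_nonneg_left (pow_le_pow_left₀ h2' h2 r) hr0
    _ = (2 * r - 1 : ℝ) ^ (2 * r) * (60 * 1036 ^ 2) ^ r / β ^ (2 * r) := by
        rw [div_pow, ← pow_mul, mul_div_assoc]

/-- **Odd powers by AM–GM between the neighbouring even ones**:
`E₀[S^{2r+1}] ≤ ((2r−1)^{2r}·C₂^r + (2r+1)^{2r+2}·C₂^{r+1}) / (2·β^{2r+1})`, `C₂ = 60·1036²` (`r ≥ 1`). -/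
theorem gaussAvg_edgeSq_pow_odd_le {β : ℝ} (hβ : 0 < β) (x : Site 4) (μ ν : Fin 4) (r : ℕ) (hr : 1 ≤ r) :
    gaussAvg β H (fun a => (∑ i : Fin 4, ‖plaqVar H x μ ν a i‖ ^ 2) ^ (2 * r + 1)) ≤
      ((2 * r - 1 : ℝ) ^ (2 * r) * (60 * 1036 ^ 2) ^ r + (2 * r + 1 : ℝ) ^ (2 * r + 2) * (60 * 1036 ^ 2) ^ (r + 1)) /
        (2 * β ^ (2 * r + 1)) := by
  -- pointwise AM–GM: `S^{2r+1} ≤ (β⁻¹ S^{2r} + β S^{2r+2}) / 2`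
  have hpt : ∀ a : LandauFree H → E3, (∑ i : Fin 4, ‖plaqVar H x μ ν a i‖ ^ 2) ^ (2 * r + 1) ≤
      (2 * β)⁻¹ * (∑ i : Fin 4, ‖plaqVar H x μ ν a i‖ ^ 2) ^ (2 * r) +
        β / 2 * (∑ i : Fin 4, ‖plaqVar H x μ ν a i‖ ^ 2) ^ (2 * r + 2) := by
    intro a
    set S := ∑ i : Fin 4, ‖plaqVar H x μ ν a i‖ ^ 2
    have hS0 : 0 ≤ S := Finset.sum_nonneg fun i _ => sq_nonneg _
    have hS2r : 0 ≤ S ^ (2 * r) := pow_nonneg hS0 _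
    have e : (2 * β)⁻¹ * S ^ (2 * r) + β / 2 * S ^ (2 * r + 2) - S ^ (2 * r + 1) = (2 * β)⁻¹ * S ^ (2 * r) * (β * S - 1) ^ 2 := by
      field_simp; ring
    nlinarith [mul_nonneg (mul_nonneg (inv_nonneg.mpr (by positivity : (0:ℝ) ≤ 2 * β)) hS2r) (sq_nonneg (β * S - 1))]
  have hint0 := integrable_edgeSq_pow_mul_gaussWeight H hβ x μ ν (2 * r)
  have hint2 := integrable_edgeSq_pow_mul_gaussWeight H hβ x μ ν (2 * r + 2)
  have hi0 : Integrable (fun a : LandauFree H → E3 =>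
      (2 * β)⁻¹ * (∑ i : Fin 4, ‖plaqVar H x μ ν a i‖ ^ 2) ^ (2 * r) * gaussWeight β H a) :=
    (hint0.const_mul ((2 * β)⁻¹)).congr (Filter.Eventually.of_forall fun a => by ring)
  have hi2 : Integrable (fun a : LandauFree H → E3 =>
      β / 2 * (∑ i : Fin 4, ‖plaqVar H x μ ν a i‖ ^ 2) ^ (2 * r + 2) * gaussWeight β H a) :=
    (hint2.const_mul (β / 2)).congr (Filter.Eventually.of_forall fun a => by ring)
  have hint : Integrable (fun a : LandauFree H → E3 =>
      ((2 * β)⁻¹ * (∑ i : Fin 4, ‖plaqVar H x μ ν a i‖ ^ 2) ^ (2 * r) +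
        β / 2 * (∑ i : Fin 4, ‖plaqVar H x μ ν a i‖ ^ 2) ^ (2 * r + 2)) * gaussWeight β H a) :=
    (hi0.add hi2).congr (Filter.Eventually.of_forall fun a => by simp only [Pi.add_apply]; ring)
  have hE0 := gaussAvg_edgeSq_pow_even_le H hβ x μ ν r hr
  have hE2 := gaussAvg_edgeSq_pow_even_le H hβ x μ ν (r + 1) (by omega)
  rw [show 2 * (r + 1) = 2 * r + 2 by ring] at hE2
  have hr1 : ((r + 1 : ℕ) : ℝ) = (r : ℝ) + 1 := by push_cast; ring
  rw [hr1, show (2 * ((r : ℝ) + 1) - 1) = (2 * r + 1 : ℝ) by ring] at hE2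
  calc gaussAvg β H (fun a => (∑ i : Fin 4, ‖plaqVar H x μ ν a i‖ ^ 2) ^ (2 * r + 1))
      ≤ gaussAvg β H (fun a => (2 * β)⁻¹ * (∑ i : Fin 4, ‖plaqVar H x μ ν a i‖ ^ 2) ^ (2 * r) +
          β / 2 * (∑ i : Fin 4, ‖plaqVar H x μ ν a i‖ ^ 2) ^ (2 * r + 2)) :=
        gaussAvg_mono H hβ (fun a => pow_nonneg (Finset.sum_nonneg fun i _ => sq_nonneg _) _) hpt hint
    _ = (2 * β)⁻¹ * gaussAvg β H (fun a => (∑ i : Fin 4, ‖plaqVar H x μ ν a i‖ ^ 2) ^ (2 * r)) +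
          β / 2 * gaussAvg β H (fun a => (∑ i : Fin 4, ‖plaqVar H x μ ν a i‖ ^ 2) ^ (2 * r + 2)) := by
        rw [gaussAvg_add H _ _ hi0 hi2, gaussAvg_const_mul, gaussAvg_const_mul]
    _ ≤ (2 * β)⁻¹ * ((2 * r - 1 : ℝ) ^ (2 * r) * (60 * 1036 ^ 2) ^ r / β ^ (2 * r)) +
          β / 2 * ((2 * r + 1 : ℝ) ^ (2 * r + 2) * (60 * 1036 ^ 2) ^ (r + 1) / β ^ (2 * r + 2)) := by
        gcongr
    _ = ((2 * r - 1 : ℝ) ^ (2 * r) * (60 * 1036 ^ 2) ^ r + (2 * r + 1 : ℝ) ^ (2 * r + 2) * (60 * 1036 ^ 2) ^ (r + 1)) /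
          (2 * β ^ (2 * r + 1)) := by
        field_simp
        ring

/-- A single edge variable is dominated by the edge energy: `‖v_i‖^{2k} ≤ S^k`. -/
theorem norm_plaqVar_pow_le_edgeSq_pow (x : Site 4) (μ ν : Fin 4) (a : LandauFree H → E3) (i : Fin 4) (k : ℕ) :
    ‖plaqVar H x μ ν a i‖ ^ (2 * k) ≤ (∑ j : Fin 4, ‖plaqVar H x μ ν a j‖ ^ 2) ^ k := by
  rw [pow_mul]
  exact pow_le_pow_left₀ (sq_nonneg _)
    (Finset.single_le_sum (f := fun j => ‖plaqVar H x μ ν a j‖ ^ 2) (fun j _ => sq_nonneg _) (Finset.mem_univ i)) k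

/-- **One edge variable**: `E₀[‖v_i‖^{2k}] ≤ E₀[S^k]`. -/
theorem gaussAvg_norm_plaqVar_pow_le {β : ℝ} (hβ : 0 < β) (x : Site 4) (μ ν : Fin 4) (i : Fin 4) (k : ℕ) :
    gaussAvg β H (fun a => ‖plaqVar H x μ ν a i‖ ^ (2 * k)) ≤
      gaussAvg β H (fun a => (∑ j : Fin 4, ‖plaqVar H x μ ν a j‖ ^ 2) ^ k) :=
  gaussAvg_mono H hβ (fun _ => pow_nonneg (norm_nonneg _) _) (fun a => norm_plaqVar_pow_le_edgeSq_pow H x μ ν a i k)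
    (integrable_edgeSq_pow_mul_gaussWeight H hβ x μ ν k)

end PlaqObsL2

end Summit.QuantumFields.YangMills.Theorems.AllWindowsColdBoxBoxHighLine

end
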